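import Mathlib
import HarnessLib
import HarnessLib.Audit
import Summits.RiemannHypothesis.Statement
import Literature.NumberTheory.LFunctions.WeilExplicit
import Literature.NumberTheory.LFunctions.RiemannXi
import Literature.NumberTheory.LFunctions.RiemannXiProofs
import Literature.NumberTheory.LFunctions.WeilWindowSimpleEven
import Literature.NumberTheory.LFunctions.WeilGroundEnergyParitySplit
import Literature.NumberTheory.LFunctions.WeilOddGroundState

/-!
# Theses-free copies of the route propositions of route `WeilParity` (build refactor)

This module restates, as plain `def … : Prop` with the SAME terms, every statement item of the route file
`Summits/RiemannHypothesis/RiemannHypothesis/Theses/WeilParity.lean` (namespace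
`Summit.RiemannHypothesis.RiemannHypothesis.Theses.WeilParity`), in the namespace
`Summit.RiemannHypothesis.RiemannHypothesis.Theorems.WeilRouteProps.WeilParity` (the route's deciding theorem `closes` is
deliberately NOT copied — gate5 ruling 2026-08-26T22:17Z).

WHY (21-frontier standing build rule 2026-08-26T18:52:29Z; director-rh BRIEF-weil-import-refactor): only LEAF modules
(closers nobody imports) may import a `Theses` (route) file, so that a route edit invalidates a few dozen leaves instead of
the ≈3 000-module cone that used to hang below the route file. Towers, certificate shards and libraries that need to
MENTION a route proposition (as a hypothesis or in a type) import this module instead; it imports exactly what the route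
file imports and never a `Theses` file.

Each copy is definitionally equal to the route declaration (same term); the leaf
`Theorems/WeilRouteProps/WeilParityIff.lean` records `Theorems.WeilRouteProps.WeilParity.X ↔ Theses.WeilParity.X` by `Iff.rfl` for every
item `X`, so a closer proves the route declaration from a tower theorem about the copy by `exact` (definitional unfolding)
or through that `Iff`. These definitions are NOT route items (no `@[route_item]`), carry no status, and must be kept
textually in sync with the route file if a statement is ever restated (the `Iff.rfl` leaf then fails loudly).
Nothing here bears on the truth of RH.
-/

namespace Summit.RiemannHypothesis.RiemannHypothesis.Theorems.WeilRouteProps.WeilParity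

open scoped BigOperators Topology Manifold Classical MeasureTheory ProbabilityTheory Matrix InnerProductSpace ComplexConjugate ContinuousMap
open Filter Set Function TopologicalSpace MeasureTheory
open Summit

/-- Theses-free copy (build refactor) of the route proposition
`Summit.RiemannHypothesis.RiemannHypothesis.Theses.WeilParity.EvenSectorWins` (item stmt-RiemannHypothesis-15430, target): the same term, hence
definitionally equal to it (`WeilRouteProps.WeilParityIff`). Not a route item; see the route file for the informal statement,
status and sources. -/
def EvenSectorWins : Prop :=
  ∀ a : ℝ, 0 < a → ∀ o : ℝ → ℂ, Literature.NumberTheory.LFunctions.IsWeilTest o → tsupport o ⊆ Set.Icc (-a) a → (∀ t, o (-t) = -o t) → ∫ t, ‖o t‖ ^ 2 = (1 : ℝ) → ∀ δ : ℝ, 0 < δ → ∃ e : ℝ → ℂ, Literature.NumberTheory.LFunctions.IsWeilTest e ∧ tsupport e ⊆ Set.Icc (-a) a ∧ (∀ t, e (-t) = e t) ∧ ∫ t, ‖e t‖ ^ 2 = (1 : ℝ) ∧ (Literature.NumberTheory.LFunctions.weilQuadratic e).re ≤ (Literature.NumberTheory.LFunctions.weilQuadratic o).re + δ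

/-- Theses-free copy (build refactor) of the route proposition
`Summit.RiemannHypothesis.RiemannHypothesis.Theses.WeilParity.OffLineParityDetection` (item stmt-RiemannHypothesis-15431, crux): the same term, hence
definitionally equal to it (`WeilRouteProps.WeilParityIff`). Not a route item; see the route file for the informal statement,
status and sources. -/
def OffLineParityDetection : Prop :=
  ∀ ρ : ℂ, riemannZeta ρ = 0 → 0 < ρ.re → ρ.re < 1 → ρ.re ≠ 1 / 2 → ∃ a : ℝ, 0 < a ∧ ∃ o : ℝ → ℂ, Literature.NumberTheory.LFunctions.IsWeilTest o ∧ tsupport o ⊆ Set.Icc (-a) a ∧ (∀ t, o (-t) = -o t) ∧ ∫ t, ‖o t‖ ^ 2 = (1 : ℝ) ∧ ∃ m : ℝ, 0 < m ∧ ∀ e : ℝ → ℂ, Literature.NumberTheory.LFunctions.IsWeilTest e → tsupport e ⊆ Set.Icc (-a) a → (∀ t, e (-t) = e t) → ∫ t, ‖e t‖ ^ 2 = (1 : ℝ) → (Literature.NumberTheory.LFunctions.weilQuadratic o).re + m ≤ (Literature.NumberTheory.LFunctions.weilQuadratic e).re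

/-- Theses-free copy (build refactor) of the route proposition
`Summit.RiemannHypothesis.RiemannHypothesis.Theses.WeilParity.EvenWinsBeyondArch` (item stmt-RiemannHypothesis-15432, crux): the same term, hence
definitionally equal to it (`WeilRouteProps.WeilParityIff`). Not a route item; see the route file for the informal statement,
status and sources. -/
def EvenWinsBeyondArch : Prop :=
  ∀ a : ℝ, Real.log 2 / 2 < a → ∀ o : ℝ → ℂ, Literature.NumberTheory.LFunctions.IsWeilTest o → tsupport o ⊆ Set.Icc (-a) a → (∀ t, o (-t) = -o t) → ∫ t, ‖o t‖ ^ 2 = (1 : ℝ) → ∀ δ : ℝ, 0 < δ → ∃ e : ℝ → ℂ, Literature.NumberTheory.LFunctions.IsWeilTest e ∧ tsupport e ⊆ Set.Icc (-a) a ∧ (∀ t, e (-t) = e t) ∧ ∫ t, ‖e t‖ ^ 2 = (1 : ℝ) ∧ (Literature.NumberTheory.LFunctions.weilQuadratic e).re ≤ (Literature.NumberTheory.LFunctions.weilQuadratic o).re + δ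

/-- Theses-free copy (build refactor) of the route proposition
`Summit.RiemannHypothesis.RiemannHypothesis.Theses.WeilParity.EvenWinsArch` (item stmt-RiemannHypothesis-15433, crux): the same term, hence
definitionally equal to it (`WeilRouteProps.WeilParityIff`). Not a route item; see the route file for the informal statement,
status and sources. -/
def EvenWinsArch : Prop :=
  ∀ a : ℝ, 0 < a → a ≤ Real.log 2 / 2 → ∀ o : ℝ → ℂ, Literature.NumberTheory.LFunctions.IsWeilTest o → tsupport o ⊆ Set.Icc (-a) a → (∀ t, o (-t) = -o t) → ∫ t, ‖o t‖ ^ 2 = (1 : ℝ) → ∀ δ : ℝ, 0 < δ → ∃ e : ℝ → ℂ, Literature.NumberTheory.LFunctions.IsWeilTest e ∧ tsupport e ⊆ Set.Icc (-a) a ∧ (∀ t, e (-t) = e t) ∧ ∫ t, ‖e t‖ ^ 2 = (1 : ℝ) ∧ (Literature.NumberTheory.LFunctions.weilQuadratic e).re ≤ (Literature.NumberTheory.LFunctions.weilQuadratic o).re + δ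

/-- Theses-free copy (build refactor) of the route proposition
`Summit.RiemannHypothesis.RiemannHypothesis.Theses.WeilParity.OnePrimeWindowSimpleEven` (item stmt-RiemannHypothesis-18084, crux): the same term, hence
definitionally equal to it (`WeilRouteProps.WeilParityIff`). Not a route item; see the route file for the informal statement,
status and sources. -/
def OnePrimeWindowSimpleEven : Prop :=
  ∀ a : ℝ, Real.log 2 / 2 < a → a ≤ Real.log 3 / 2 → Literature.NumberTheory.LFunctions.WeilWindowSimpleEven a

/-- Theses-free copy (build refactor) of the route proposition
`Summit.RiemannHypothesis.RiemannHypothesis.Theses.WeilParity.NoParityCrossing` (item stmt-RiemannHypothesis-18085, crux): the same term, hence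
definitionally equal to it (`WeilRouteProps.WeilParityIff`). Not a route item; see the route file for the informal statement,
status and sources. -/
def NoParityCrossing : Prop :=
  ∀ a : ℝ, Real.log 3 / 2 < a → Literature.NumberTheory.LFunctions.weilEvenGroundEnergy a ≠ Literature.NumberTheory.LFunctions.weilOddGroundEnergy a

/-- Theses-free copy (build refactor) of the route proposition
`Summit.RiemannHypothesis.RiemannHypothesis.Theses.WeilParity.ParityGlue` (item stmt-RiemannHypothesis-15434, support): the same term, hence
definitionally equal to it (`WeilRouteProps.WeilParityIff`). Not a route item; see the route file for the informal statement,
status and sources. -/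
def ParityGlue : Prop :=
  EvenWinsArch → EvenWinsBeyondArch → EvenSectorWins

/-- Theses-free copy (build refactor) of the route proposition
`Summit.RiemannHypothesis.RiemannHypothesis.Theses.WeilParity.FiniteDefectParityAlternation` (item stmt-RiemannHypothesis-15435, support): the same term, hence
definitionally equal to it (`WeilRouteProps.WeilParityIff`). Not a route item; see the route file for the informal statement,
status and sources. -/
def FiniteDefectParityAlternation : Prop :=
  ({ρ : ℂ | riemannZeta ρ = 0 ∧ 0 < ρ.re ∧ ρ.re < 1 ∧ ρ.re ≠ 1 / 2}).Finite → (∃ ρ : ℂ, riemannZeta ρ = 0 ∧ 0 < ρ.re ∧ ρ.re < 1 ∧ ρ.re ≠ 1 / 2) → ∃ a : ℝ, 0 < a ∧ ∃ o : ℝ → ℂ, Literature.NumberTheory.LFunctions.IsWeilTest o ∧ tsupport o ⊆ Set.Icc (-a) a ∧ (∀ t, o (-t) = -o t) ∧ ∫ t, ‖o t‖ ^ 2 = (1 : ℝ) ∧ ∃ m : ℝ, 0 < m ∧ ∀ e : ℝ → ℂ, Literature.NumberTheory.LFunctions.IsWeilTest e → tsupport e ⊆ Set.Icc (-a) a → (∀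 t, e (-t) = e t) → ∫ t, ‖e t‖ ^ 2 = (1 : ℝ) → (Literature.NumberTheory.LFunctions.weilQuadratic o).re + m ≤ (Literature.NumberTheory.LFunctions.weilQuadratic e).re

/-- Theses-free copy (build refactor) of the route proposition
`Summit.RiemannHypothesis.RiemannHypothesis.Theses.WeilParity.RHImpliesEvenWins` (item stmt-RiemannHypothesis-15436, support): the same term, hence
definitionally equal to it (`WeilRouteProps.WeilParityIff`). Not a route item; see the route file for the informal statement,
status and sources. -/
def RHImpliesEvenWins : Prop :=
  Summit.RiemannHypothesis → EvenSectorWins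

/-- Theses-free copy (build refactor) of the route proposition
`Summit.RiemannHypothesis.RiemannHypothesis.Theses.WeilParity.EvenWinsBeyondArchOfPieces` (item stmt-RiemannHypothesis-17975, support): the same term, hence
definitionally equal to it (`WeilRouteProps.WeilParityIff`). Not a route item; see the route file for the informal statement,
status and sources. -/
def EvenWinsBeyondArchOfPieces : Prop :=
  OnePrimeWindowSimpleEven → NoParityCrossing → EvenWinsBeyondArch

/-- Theses-free copy (build refactor) of the route proposition
`Summit.RiemannHypothesis.RiemannHypothesis.Theses.WeilParity.Assembly` (item stmt-RiemannHypothesis-15437, assembly): the same term, hence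
definitionally equal to it (`WeilRouteProps.WeilParityIff`). Not a route item; see the route file for the informal statement,
status and sources. -/
def Assembly : Prop :=
  EvenSectorWins → OffLineParityDetection → Summit.RiemannHypothesis

end Summit.RiemannHypothesis.RiemannHypothesis.Theorems.WeilRouteProps.WeilParity
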